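import Summits.AtomisticToContinuum.Crystallization.Theses.PalmUnimodularRigidity
import Summits.AtomisticToContinuum.Crystallization.Theorems.MinimiserShells.Negative.LoadBearing
import Summits.AtomisticToContinuum.Crystallization.Theorems.MinimiserShells.Negative.Rootedness
import Summits.AtomisticToContinuum.Crystallization.Theorems.PalmUnimodularRigidityMinimiserShellsEquilibriumInLawRepair
import Literature.Probability.Process.PointStationaryLaw
import Literature.MathematicalPhysics.StatisticalMechanics.RootEnergy
import Literature.MathematicalPhysics.StatisticalMechanics.MuGSC

/-!
# Thinning to a separated net, and the window inequality

Helper file for stub `stub_equilibriumInLaw` (S1) of line `equilibrium-in-law-surgery`, crux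
`MinimiserShells` (stmt-AtomisticToContinuum-9225): blueprint lemmas 5 and 7.

* `exists_separated_net` — a `δ`-separated finite set `G ⊆ ℝ³` contains a `D`-separated subset
  `Y` with `#G ≤ (2D/δ + 1)³ #Y` (a maximal `D`-separated subset is a `D`-net; packing).
* `window_inequality` — for every hard core `δ`, modification size `(n₀, k)`, radius `r` and
  margin `ε > 0` there are a depth `R₀` and a constant `c > 0` such that for every `δ`-separated
  `S`, every finite window `C ⊆ S` and every set `G ⊆ C` of `R₀`-DEEP atoms (`S ∩ B̄(y, R₀) ⊆ C`)
  each admitting a GAINING modification of type `(n₀, k, r, ε)` (remove `n₀` atoms and insert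
  `k` points within `r` of `y`, lowering Sütő's functional at `μ = e*` by `≥ ε`):
  `#C · e* + c · #G ≤ (∑∑_C V_LJ)/2`.  (Thinning to a `D`-net, then the multi-site cluster
  repair `le_half_sum_sum_of_repairSites` with explicit `R₀`, `D`.)
-/

noncomputable section

open MeasureTheory
open scoped ENNReal BigOperators

namespace Summit.AtomisticToContinuum.Crystallization.Theorems.PalmUnimodularRigidityMinimiserShells.EquilibriumInLaw.Window

open Literature.Probability.Process (IsPointStationaryLaw IsRootedHardCore count_restrict_singleton_ne_zero_iff
  map_sub_count_restrict)
open Literature.MathematicalPhysics.StatisticalMechanics (lennardJones IsMuGSC UniformlyDiscrete)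
open Summit.AtomisticToContinuum.Crystallization.Theses.PalmUnimodularRigidity (MinimiserShells UnimodularEnergyLowerBound)
open Summit.AtomisticToContinuum.Crystallization.Theorems.MinimiserShells.Negative.LoadBearing
  (eStar meanRootEnergy GoodShell minimiserShells_iff)
open Literature.MathematicalPhysics.StatisticalMechanics (interactionEnergy fieldEnergy
  card_le_of_separated_of_dist_le)
open Summit.AtomisticToContinuum.Crystallization.Theorems.MinimiserShells.Negative.Rootedness (E3)
open Summit.AtomisticToContinuum.Crystallization.Theorems.PalmUnimodularRigidityMinimiserShells.EquilibriumInLaw.Repair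
  (le_half_sum_sum_of_repairSites)

/-! ## Thinning -/

/-- **Thinning to a separated net.** A finite `δ`-separated set `G ⊆ ℝ³` (`δ > 0`) contains, for
every `D ≥ δ`, a `D`-separated subset `Y` with `#G ≤ (2D/δ + 1)³ · #Y`: a `D`-separated subset of
maximal size is a `D`-net of `G`, and each ball `B̄(y, D)` holds at most `(2D/δ+1)³` points of
`G` (packing, `card_le_of_separated_of_dist_le`). -/
theorem exists_separated_net (G : Finset E3) {δ D : ℝ} (hδ : 0 < δ) (hD : δ ≤ D)
    (hsep : ∀ x ∈ G, ∀ y ∈ G, x ≠ y → δ ≤ dist x y) :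
    ∃ Y : Finset E3, Y ⊆ G ∧ (∀ x ∈ Y, ∀ y ∈ Y, x ≠ y → D ≤ dist x y) ∧
      (G.card : ℝ) ≤ (2 * D / δ + 1) ^ 3 * Y.card := by
  classical
  have hD0 : 0 < D := hδ.trans_le hD
  set fam := G.powerset.filter (fun Y => ∀ x ∈ Y, ∀ y ∈ Y, x ≠ y → D ≤ dist x y) with hfam
  have hne : fam.Nonempty := ⟨∅, by simp [hfam]⟩
  obtain ⟨Y, hYfam, hYmax⟩ := Finset.exists_max_image fam Finset.card hne
  obtain ⟨hYG, hYsep⟩ := Finset.mem_filter.1 hYfam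
  rw [Finset.mem_powerset] at hYG
  refine ⟨Y, hYG, hYsep, ?_⟩
  -- `Y` is a `D`-net of `G`
  have hnet : ∀ g ∈ G, ∃ y ∈ Y, dist g y < D := by
    intro g hg
    by_contra hno
    push Not at hno
    have hgY : g ∉ Y := fun h => absurd (hno g h) (by rw [dist_self]; exact not_le.2 hD0)
    have hins : insert g Y ∈ fam := by
      refine Finset.mem_filter.2 ⟨Finset.mem_powerset.2 (Finset.insert_subset hg hYG), ?_⟩
      intro x hx y hy hxy
      rcases Finset.mem_insert.1 hx with rfl | hx' <;> rcases Finset.mem_insert.1 hy with rfl | hy'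
      · exact absurd rfl hxy
      · exact hno y hy'
      · rw [dist_comm]; exact hno x hx'
      · exact hYsep x hx' y hy' hxy
    have := hYmax _ hins
    rw [Finset.card_insert_of_notMem hgY] at this
    omega
  -- cover `G` by the balls about `Y`
  have hcover : G ⊆ Y.biUnion fun y => G.filter fun g => dist g y ≤ D := by
    intro g hg
    obtain ⟨y, hy, hgy⟩ := hnet g hg
    exact Finset.mem_biUnion.2 ⟨y, hy, Finset.mem_filter.2 ⟨hg, hgy.le⟩⟩
  have hball : ∀ y ∈ Y, ((G.filter fun g => dist g y ≤ D).card : ℝ) ≤ (2 * D / δ + 1) ^ 3 := by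
    intro y _
    have := card_le_of_separated_of_dist_le (G.filter fun g => dist g y ≤ D) y hδ hD0.le
      (fun c hc => (Finset.mem_filter.1 hc).2)
      (fun c hc d hd hcd => hsep c (Finset.mem_filter.1 hc).1 d (Finset.mem_filter.1 hd).1 hcd)
    rwa [finrank_euclideanSpace_fin] at this
  calc (G.card : ℝ) ≤ ((Y.biUnion fun y => G.filter fun g => dist g y ≤ D).card : ℝ) := by
        exact_mod_cast Finset.card_le_card hcover
    _ ≤ ∑ y ∈ Y, ((G.filter fun g => dist g y ≤ D).card : ℝ) := by
        exact_mod_cast Finset.card_biUnion_le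
    _ ≤ ∑ y ∈ Y, (2 * D / δ + 1) ^ 3 := Finset.sum_le_sum hball
    _ = (2 * D / δ + 1) ^ 3 * Y.card := by rw [Finset.sum_const, nsmul_eq_mul, mul_comm]

/-! ## The window inequality -/

/-- **Window inequality.** For every hard core `δ > 0`, modification size `(n₀, k)`, radius
`r ≥ 0` and margin `ε > 0` there are a depth `R₀ > 0` and a constant `c > 0` such that: for every
`δ`-separated `S ⊆ ℝ³`, every predicate `Gain` on points such that every `Gain`-point `y` admits a
finite modification "remove the `n₀` distinct points `xf ⊆ S ∩ B̄(y, r)`, insert the `k` distinct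
points `R ⊆ B̄(y, r)` off `S ∖ xf`" gaining `≥ ε` in Sütő's functional at `μ = e*`, every finite
window `C ⊆ S` and every `G ⊆ C` consisting of `R₀`-deep `Gain`-points:
`#C · e* + c · #G ≤ (∑_{x ∈ C} ∑_{z ∈ C} V_LJ(|x − z|))/2`. -/
theorem window_inequality {δ : ℝ} (hδ : 0 < δ) (n₀ k : ℕ) {r ε : ℝ} (hr : 0 ≤ r) (hε : 0 < ε) :
    ∃ R₀ c : ℝ, 0 < R₀ ∧ 0 < c ∧
      ∀ (S : Set E3), (∀ x ∈ S, ∀ z ∈ S, x ≠ z → δ ≤ dist x z) →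
      ∀ (Gain : E3 → Prop),
        (∀ y, Gain y → ∃ (xf : Fin n₀ → E3) (R : Fin k → E3),
          Function.Injective xf ∧ Set.range xf ⊆ S ∧ (∀ l, dist (xf l) y ≤ r) ∧
          Function.Injective R ∧ (∀ i, dist (R i) y ≤ r) ∧
          Disjoint (Set.range R) (S \ Set.range xf) ∧
          interactionEnergy lennardJones R + fieldEnergy lennardJones R (S \ Set.range xf) -
              eStar * k + ε ≤
            interactionEnergy lennardJones xf + fieldEnergy lennardJones xf (S \ Set.range xf) -
              eStar * n₀) →
      ∀ (C : Finset E3), (↑C : Set E3) ⊆ S → ∀ (G : Finset E3), G ⊆ C →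
        (∀ y ∈ G, Gain y ∧ S ∩ Metric.closedBall y R₀ ⊆ ↑C) →
        (C.card : ℝ) * eStar + c * G.card ≤ (∑ x ∈ C, ∑ z ∈ C, lennardJones (dist x z)) / 2 := by
  -- explicit constants
  set N : ℝ := (n₀ : ℝ) + k with hN
  have hN0 : 0 ≤ N := by positivity
  set D : ℝ := 4 * r + max 1 δ + 8000 * N ^ 2 / ε with hDdef
  set R₀ : ℝ := r + max 1 δ + 1000 * N * δ⁻¹ ^ 4 / ε with hR₀def
  have h1 : 1 ≤ max 1 δ := le_max_left _ _
  have hδm : δ ≤ max 1 δ := le_max_right _ _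
  have hA0 : 0 ≤ 8000 * N ^ 2 / ε := by positivity
  have hB0 : 0 ≤ 1000 * N * δ⁻¹ ^ 4 / ε := by positivity
  have hD1 : 1 ≤ D := by linarith
  have hD0 : 0 < D := by linarith
  have hδD : δ ≤ D := by linarith
  have hR₀r : r + max 1 δ ≤ R₀ := by linarith
  have hR₀0 : 0 < R₀ := by linarith
  have hD4 : 4 * r + max 1 δ ≤ D := by linarith
  -- cross terms small
  have hcross : 4000 * N ^ 2 * D⁻¹ ^ 6 ≤ ε / 2 := by
    have hDi : D⁻¹ ≤ 1 := inv_le_one_of_one_le₀ hD1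
    have hDi0 : 0 ≤ D⁻¹ := inv_nonneg.2 hD0.le
    have hD6 : D⁻¹ ^ 6 ≤ D⁻¹ := by
      calc D⁻¹ ^ 6 ≤ D⁻¹ ^ 1 := pow_le_pow_of_le_one hDi0 hDi (by norm_num)
        _ = D⁻¹ := pow_one _
    have hkey : 8000 * N ^ 2 * D⁻¹ ≤ ε := by
      have hle : 8000 * N ^ 2 / ε ≤ D := by linarith
      rw [div_le_iff₀ hε] at hle
      calc 8000 * N ^ 2 * D⁻¹ ≤ D * ε * D⁻¹ := by gcongr
        _ = ε := by field_simp
    nlinarith [mul_le_mul_of_nonneg_left hD6 (by positivity : (0 : ℝ) ≤ 4000 * N ^ 2)]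
  -- tails small
  have htail : 500 * N * (δ⁻¹ ^ 4 * (R₀ - r)⁻¹ ^ 2) ≤ ε / 2 := by
    have hRr1 : 1 ≤ R₀ - r := by linarith
    have hRr0 : 0 < R₀ - r := by linarith
    have hRi : (R₀ - r)⁻¹ ≤ 1 := inv_le_one_of_one_le₀ hRr1
    have hRi0 : 0 ≤ (R₀ - r)⁻¹ := inv_nonneg.2 hRr0.le
    have hR2 : (R₀ - r)⁻¹ ^ 2 ≤ (R₀ - r)⁻¹ := by
      calc (R₀ - r)⁻¹ ^ 2 ≤ (R₀ - r)⁻¹ ^ 1 := pow_le_pow_of_le_one hRi0 hRi (by norm_num)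
        _ = (R₀ - r)⁻¹ := pow_one _
    have hkey : 1000 * N * δ⁻¹ ^ 4 * (R₀ - r)⁻¹ ≤ ε := by
      have hle : 1000 * N * δ⁻¹ ^ 4 / ε ≤ R₀ - r := by linarith
      rw [div_le_iff₀ hε] at hle
      calc 1000 * N * δ⁻¹ ^ 4 * (R₀ - r)⁻¹ ≤ (R₀ - r) * ε * (R₀ - r)⁻¹ := by gcongr
        _ = ε := by field_simp
    nlinarith [mul_le_mul_of_nonneg_left hR2 (by positivity : (0 : ℝ) ≤ 500 * N * δ⁻¹ ^ 4)]
  -- the constant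
  set K : ℝ := (2 * D / δ + 1) ^ 3 with hK
  have hK0 : 0 < K := by positivity
  refine ⟨R₀, ε / (2 * K), hR₀0, by positivity, ?_⟩
  intro S hsep Gain hGain C hCS G hGC hG
  -- thin the gain sites to a `D`-net
  obtain ⟨Y, hYG, hYsep, hcard⟩ := exists_separated_net G hδ hδD
    (fun x hx y hy hxy => hsep x (hCS (hGC hx)) y (hCS (hGC hy)) hxy)
  -- enumerate the net and choose the modifications
  set m := Y.card with hm
  set y : Fin m → E3 := fun j => ((Y.equivFin.symm j : Y) : E3) with hy
  have hyY : ∀ j, y j ∈ Y := fun j => (Y.equivFin.symm j).2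
  have hyinj : Function.Injective y := fun j j' h =>
    Y.equivFin.symm.injective (Subtype.val_injective h)
  have hyD : ∀ j i, j ≠ i → D ≤ dist (y j) (y i) := fun j i hji =>
    hYsep _ (hyY j) _ (hyY i) fun h => hji (hyinj h)
  choose xf R hxf hxfS hxfr hRinj hRr hRdisj hgain using
    fun j => hGain (y j) (hG _ (hYG (hyY j))).1
  have key := le_half_sum_sum_of_repairSites hδ hsep C hCS hr hR₀r htail hD4 hcross y xf R hyD
    (fun j => (hG _ (hYG (hyY j))).2) hxf hxfS hxfr hRinj hRr hRdisj hgain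
  -- `c · #G ≤ m ε / 2`
  have hcG : ε / (2 * K) * G.card ≤ m * (ε / 2) := by
    rw [div_mul_eq_mul_div, div_le_iff₀ (by positivity)]
    calc ε * G.card ≤ ε * (K * m) := by
          refine mul_le_mul_of_nonneg_left ?_ hε.le
          rw [hK, hm]; exact hcard
      _ = m * (ε / 2) * (2 * K) := by ring
  linarith

/-- Registered stub marker (helper part 5/14 of `stub_equilibriumInLaw`, line `equilibrium-in-law-surgery`):
the window inequality `window_inequality`, closed form. -/
theorem stub_equilibriumInLaw_part05 :
    ∀ (δ : ℝ), 0 < δ → ∀ (n₀ k : ℕ) (r ε : ℝ), 0 ≤ r → 0 < ε →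
    ∃ R₀ c : ℝ, 0 < R₀ ∧ 0 < c ∧
      ∀ (S : Set (EuclideanSpace ℝ (Fin 3))), (∀ x ∈ S, ∀ z ∈ S, x ≠ z → δ ≤ dist x z) →
      ∀ (Gain : EuclideanSpace ℝ (Fin 3) → Prop),
        (∀ y, Gain y → ∃ (xf : Fin n₀ → EuclideanSpace ℝ (Fin 3)) (R : Fin k → EuclideanSpace ℝ (Fin 3)),
          Function.Injective xf ∧ Set.range xf ⊆ S ∧ (∀ l, dist (xf l) y ≤ r) ∧
          Function.Injective R ∧ (∀ i, dist (R i) y ≤ r) ∧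
          Disjoint (Set.range R) (S \ Set.range xf) ∧
          interactionEnergy lennardJones R + fieldEnergy lennardJones R (S \ Set.range xf) -
              eStar * k + ε ≤
            interactionEnergy lennardJones xf + fieldEnergy lennardJones xf (S \ Set.range xf) -
              eStar * n₀) →
      ∀ (C : Finset (EuclideanSpace ℝ (Fin 3))), (↑C : Set (EuclideanSpace ℝ (Fin 3))) ⊆ S →
      ∀ (G : Finset (EuclideanSpace ℝ (Fin 3))), G ⊆ C →
        (∀ y ∈ G, Gain y ∧ S ∩ Metric.closedBall y R₀ ⊆ ↑C) →
        (C.card : ℝ) * eStar + c * G.card ≤ (∑ x ∈ C, ∑ z ∈ C, lennardJones (dist x z)) / 2 :=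
  fun _ hδ n₀ k _ _ hr hε => window_inequality hδ n₀ k hr hε

end Summit.AtomisticToContinuum.Crystallization.Theorems.PalmUnimodularRigidityMinimiserShells.EquilibriumInLaw.Window

end
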